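import Summits.ResolutionOfSingularities.ResolutionOfSingularities.Theorems.RadicialJungCleanModelsLens5KbarReadOff2
import Summits.ResolutionOfSingularities.ResolutionOfSingularities.Theorems.RadicialJungCleanModelsLens5KbarCossartPackaging
import Summits.ResolutionOfSingularities.ResolutionOfSingularities.Theorems.RadicialJungCleanModelsLens5KbarCossartGlobalToLocal
import HarnessLib

/-!
# Route `RadicialJung`, crux `CleanModels` (stmt-15917) — lens 5, the `k = k̄` anchor of stub :249, part 5/5 (CONSUMER):
# the `k = k̄` slice of `stub_cleanLU3DefectNonDiscrete` (Sketch rev 26 :249) — indeed of the whole node `cleanLU3_of_stubs` (:354) —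
# modulo the printed theorem `Cossart1987Thm` (Cossart 1987, F-112) ALONE

Port (res-B-lead-1 g6) of §9 (glue) / §11 / §14 of the crux workfile `Cruxes/DescentPerfectToAll/Lens5_KbarCossartAnchor.lean` rev 12 (author:
res-B-lens-5 g11), with the §14 twin RE-POINTED from Sketch rev 25 (:238) to Sketch rev 26 (:249, one more discarded class hypothesis
`¬(PerfectField k ∧ [Γ:pΓ] = p²)`), DEF-FREE, binding `(h : Literature.AlgebraicGeometry.Resolution.Cossart1987Thm)` — NAMED FACT ✓ F-112,
`Literature/AlgebraicGeometry/Resolution/CossartFunctionNormalForm3.lean` (a PRINTED theorem typed as a hypothesis; nothing is proved by binding it).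
OURS · counted 0.  Nothing here proves resolution in characteristic `p`; resolution in char `p` is NOT proved.

* `looseCleanRep_of_nuZeroAt` — LEMMA G along the valuation, EVERY ground field `k` of characteristic `p` (kernel: (G-pb)
  ✓ `exists_isPBasisOver_locAtCentre` + (G-alg) ✓ `ReadOff.readOff_core`): at the regular local ring `locAtCentre A' O` of a finitely generated
  model with maximal centre, Cossart's `ν = 0` for `f ∉ K^p` gives a loosely clean two-term representative `c₀^p + c₁^p f`, `c₁ ≠ 0`.
* `cleanLU3_algClosed_of_cossart1987Thm` — the statement of the lead's kernel composition `cleanLU3_of_stubs` (Sketch rev 26 :354: clean local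
  uniformization at EVERY zero-dimensional valuation ring with a 3-dimensional regular centre, hypotheses only up to `g₀ ∉ K^p`) VERBATIM with the
  single extra binder `[IsAlgClosed k]`, from `Cossart1987Thm` alone: clear the denominator (`f := b^p g₀ ∈ A`), ✓ `nuZeroAlongValuation_of_cossart1987Thm`,
  `looseCleanRep_of_nuZeroAt`, ✓ `concl_of_looseCleanRep`.
* `cleanLU3DefectNonDiscrete_algClosed_of_cossart1987Thm` — **THE CONSUMER OF RECORD**: Sketch rev 26 :249 `stub_cleanLU3DefectNonDiscrete`
  VERBATIM + `[IsAlgClosed k]`, by discarding the five valuation-class hypotheses.  Sketch rev 27 narrows the research stub by `¬ IsAlgClosed k`.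
-/

noncomputable section

set_option linter.dupNamespace false

open IsLocalRing
open Literature.AlgebraicGeometry.Resolution
open Summit.ResolutionOfSingularities.ResolutionOfSingularities.Theorems.RadicialJung.CleanModels
open Literature.RingTheory.PBasis

namespace Summit.ResolutionOfSingularities.ResolutionOfSingularities.Theorems.RadicialJung.CleanModels.Lens5.KbarCossart

/-- **LEMMA G along the valuation, for EVERY ground field `k` of characteristic `p`** (the lens-5 support shape
`NuZeroReadOffAlongValuationAt p`, spelled out; kernel: (G-pb) ✓ `exists_isPBasisOver_locAtCentre` + (G-alg) ✓ `ReadOff.readOff_core`):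
at the regular local ring `S' = locAtCentre A' O` of a finitely generated model `A' ⊆ O` with MAXIMAL centre, `ν = 0` (`NuZeroAt`) for
`f ∈ S'`, `f ∉ K^p`, yields `c₀, c₁ ∈ K`, `c₁ ≠ 0`, with `c₀^p + c₁^p f` in one of the three loosely clean forms (1)/(2)/(3) at `S'`. [folklore] -/
theorem looseCleanRep_of_nuZeroAt (p : ℕ) [Fact p.Prime] (k : Type) [Field k] [CharP k p] (K : Type) [Field K] [Algebra k K]
    (O : ValuationSubring K) (A' : Subalgebra k K) (hA'O : A'.toSubring ≤ O.toSubring) (hA'fg : A'.FG)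
    (hfrac : IsFractionRing A' K) (hmax : (subringCentre A'.toSubring O hA'O).IsMaximal)
    (hreg : IsRegularLocalRing (locAtCentre A'.toSubring O)) (f : K) (hfS : f ∈ locAtCentre A'.toSubring O)
    (hf : ∀ c : K, c ^ p ≠ f) (hN : NuZeroAt (⟨f, hfS⟩ : ↥(locAtCentre A'.toSubring O))) :
    ∃ c₀ c₁ : K, c₁ ≠ 0 ∧
    ((∃ (d' m : ℕ) (hmd : m ≤ d') (t' : Fin d' → ↥(locAtCentre A'.toSubring O)) (a' : Fin m → ℕ)
        (w : ↥(locAtCentre A'.toSubring O)), IsUnit w ∧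
        Ideal.span (Set.range t') = maximalIdeal ↥(locAtCentre A'.toSubring O) ∧
        ringKrullDim ↥(locAtCentre A'.toSubring O) = (d' : WithBot ℕ∞) ∧ 0 < m ∧ (∀ i, ¬ p ∣ a' i) ∧
        c₀ ^ p + c₁ ^ p * f = (w : K) * ∏ i : Fin m, ((t' (Fin.castLE hmd i) : ↥(locAtCentre A'.toSubring O)) : K) ^ (a' i)) ∨
     (∃ w : ↥(locAtCentre A'.toSubring O), IsUnit w ∧ c₀ ^ p + c₁ ^ p * f = (w : K) ∧
        ∀ c : ↥(locAtCentre A'.toSubring O), w - c ^ p ∉ maximalIdeal ↥(locAtCentre A'.toSubring O)) ∨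
     (∃ s c : ↥(locAtCentre A'.toSubring O), c₀ ^ p + c₁ ^ p * f = (s : K) ∧
        s - c ^ p ∈ maximalIdeal ↥(locAtCentre A'.toSubring O) ∧ s - c ^ p ∉ maximalIdeal ↥(locAtCentre A'.toSubring O) ^ 2)) := by
  classical
  haveI : CharP K p := charP_of_injective_algebraMap (algebraMap k K).injective p
  haveI : IsRegularLocalRing ↥(locAtCentre A'.toSubring O) := hreg
  haveI := hfrac
  haveI : IsFractionRing ↥(locAtCentre A'.toSubring O) K := isFractionRing_locAtCentre (le_refl A') O
  obtain ⟨d, e, hed, t, b, ht, hd, hJ⟩ := hN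
  obtain ⟨Γ, htΓ, hΓ⟩ := exists_isPBasisOver_locAtCentre p k K O A' hA'O hA'fg hmax t ht hd
  have hf' : ∀ c : K, c ^ p ≠ algebraMap (↥(locAtCentre A'.toSubring O)) K ⟨f, hfS⟩ := hf
  obtain ⟨c₀, c₁, hc₁, hforms⟩ :=
    ReadOff.readOff_core hΓ hed t (fun i => t (Fin.castLE hed i)) (fun _ => rfl) b ht hd htΓ ⟨f, hfS⟩ hf' hJ
  have hfK : algebraMap (↥(locAtCentre A'.toSubring O)) K ⟨f, hfS⟩ = f := rfl
  rw [hfK] at hforms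
  refine ⟨c₀, c₁, hc₁, ?_⟩
  rcases hforms with ⟨d', m, hmd, t', a', w, hw, ht', hd', hm, ha', heq⟩ | ⟨w, hw, heq, hres⟩ | ⟨s, c', heq, hm1, hm2⟩
  · refine Or.inl ⟨d', m, hmd, t', a', w, hw, ht', hd', hm, ha', ?_⟩
    rw [heq, map_mul, map_prod]
    simp_rw [map_pow]
    rfl
  · exact Or.inr (Or.inl ⟨w, hw, heq, hres⟩)
  · exact Or.inr (Or.inr ⟨s, c', heq, hm1, hm2⟩)

/-- **THE `k̄`-SLICE OF THE WHOLE NODE `cleanLU3_of_stubs` (Sketch rev 26 :354) MODULO THE PRINTED THEOREM ALONE**: statement = :354–372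
VERBATIM with the single extra binder `[IsAlgClosed k]`; hypothesis `Cossart1987Thm` (F-112).  Over `k̄` this one theorem covers, at that node, EVERY
zero-dimensional valuation class (defectless or not, Abhyankar or not, discrete / (C-div) / `[Γ:pΓ] = p²` or not): clear the denominator
(`f := b^p g₀ ∈ A`, not a `p`-th power), take the regular chart of ✓ `nuZeroAlongValuation_of_cossart1987Thm` with `ν = 0` for `f`, read off a
loosely clean representative by ✓ `looseCleanRep_of_nuZeroAt` (LEMMA G), repackage with `c := (c₀, c₁ b, 0, …, 0)` (✓ `concl_of_looseCleanRep`).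
(Author of the argument: res-B-lens-5 g11.) [folklore] -/
theorem cleanLU3_algClosed_of_cossart1987Thm (p : ℕ) (h : Cossart1987Thm) :
    p.Prime →
    ∀ (k : Type) [Field k] [CharP k p] [IsAlgClosed k] (K : Type) [Field K] [Algebra k K]
    (O : ValuationSubring K) (A : Subalgebra k K), A.toSubring ≤ O.toSubring → A.FG → IsFractionRing A K →
    ringKrullDim A ≤ 3 → IsRegularLocalRing (locAtCentre A.toSubring O) →
    ringKrullDim (locAtCentre A.toSubring O) = 3 →
    (∀ (T : Subring K) (hT : T ≤ O.toSubring), A.toSubring ≤ T → (subringCentre T O hT).IsMaximal) →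
    ∀ g₀ : K, (∀ c : K, c ^ p ≠ g₀) →
    ∃ (A' : Subalgebra k K), A'.toSubring ≤ O.toSubring ∧ A ≤ A' ∧ A'.FG ∧
    ∃ (_ : IsRegularLocalRing (locAtCentre A'.toSubring O)) (c : Fin p → K), (∃ j : Fin p, (j : ℕ) ≠ 0 ∧ c j ≠ 0) ∧
    ((∃ (d m : ℕ) (hmd : m ≤ d) (t : Fin d → ↥(locAtCentre A'.toSubring O)) (a : Fin m → ℕ) (u : ↥(locAtCentre A'.toSubring O)), IsUnit u ∧
    Ideal.span (Set.range t) = IsLocalRing.maximalIdeal ↥(locAtCentre A'.toSubring O) ∧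
    ringKrullDim ↥(locAtCentre A'.toSubring O) = (d : WithBot ℕ∞) ∧ 0 < m ∧ (∀ i, ¬ p ∣ a i) ∧
    (∑ j : Fin p, c j ^ p * g₀ ^ (j : ℕ)) = (u : K) * ∏ i : Fin m, ((t (Fin.castLE hmd i) : ↥(locAtCentre A'.toSubring O)) : K) ^ (a i)) ∨
    (∃ u : ↥(locAtCentre A'.toSubring O), IsUnit u ∧ (∑ j : Fin p, c j ^ p * g₀ ^ (j : ℕ)) = (u : K) ∧
    ∀ c' : ↥(locAtCentre A'.toSubring O), u - c' ^ p ∉ IsLocalRing.maximalIdeal ↥(locAtCentre A'.toSubring O)) ∨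
    (∃ s c' : ↥(locAtCentre A'.toSubring O), (∑ j : Fin p, c j ^ p * g₀ ^ (j : ℕ)) = (s : K) ∧
    s - c' ^ p ∈ IsLocalRing.maximalIdeal ↥(locAtCentre A'.toSubring O) ∧
    s - c' ^ p ∉ IsLocalRing.maximalIdeal ↥(locAtCentre A'.toSubring O) ^ 2)) := by
  intro hp k _ _ _ K _ _ O A hAO hAfg hfrac _hdimA hreg hdim3 hzd g₀ hg₀
  classical
  haveI : Fact p.Prime := ⟨hp⟩
  haveI := hfrac
  obtain ⟨b, hb0, hbA, hfA⟩ := exists_pow_mul_mem p hp A g₀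
  set f : K := b ^ p * g₀ with hfdef
  have hf : ∀ c : K, c ^ p ≠ f := by
    intro c hc
    apply hg₀ (c / b)
    rw [div_pow, hc, hfdef, mul_comm, mul_div_cancel_right₀ _ (pow_ne_zero _ hb0)]
  obtain ⟨A', hA'O, hAA', hA'fg, hreg', hfS, hN'⟩ :=
    nuZeroAlongValuation_of_cossart1987Thm h p k K O A hAO hAfg hfrac hreg hdim3 hzd f hfA hf
  haveI : IsFractionRing A' K := isFractionRing_of_le' hAA'
  have hmax : (subringCentre A'.toSubring O hA'O).IsMaximal := hzd A'.toSubring hA'O (fun x hx => hAA' hx)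
  haveI : IsRegularLocalRing ↥(locAtCentre A'.toSubring O) := hreg'
  exact concl_of_looseCleanRep (hreg' := hreg') hp O A A' hA'O hAA' hA'fg g₀ b hb0
    (looseCleanRep_of_nuZeroAt p k K O A' hA'O hA'fg inferInstance hmax hreg' f hfS hf hN')

/-- **THE CONSUMER OF RECORD — Sketch rev 26 :249 `stub_cleanLU3DefectNonDiscrete` VERBATIM + `[IsAlgClosed k]`, modulo the printed theorem
`Cossart1987Thm` (F-112) alone**: from `cleanLU3_algClosed_of_cossart1987Thm` by discarding the five valuation-class / field hypotheses («no best
`p`-th-power approximation», «transcendence defect `≠ 0`», «not discrete of rank one», «no divisorial coarsening», «not (perfect `k` and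
`[Γ:pΓ] = p²`)»).  This closes the `k = k̄` slice of the research residual of crux stmt-15917's dim-3 branch; Sketch rev 27 narrows the stub by
`¬ IsAlgClosed k`.  (Author of the argument: res-B-lens-5 g11; port res-B-lead-1 g6.) [folklore] -/
theorem cleanLU3DefectNonDiscrete_algClosed_of_cossart1987Thm (p : ℕ) (h : Cossart1987Thm) :
    p.Prime →
    ∀ (k : Type) [Field k] [CharP k p] [IsAlgClosed k] (K : Type) [Field K] [Algebra k K]
    (O : ValuationSubring K) (A : Subalgebra k K), A.toSubring ≤ O.toSubring → A.FG → IsFractionRing A K →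
    ringKrullDim A ≤ 3 → IsRegularLocalRing (locAtCentre A.toSubring O) →
    ringKrullDim (locAtCentre A.toSubring O) = 3 →
    (∀ (T : Subring K) (hT : T ≤ O.toSubring), A.toSubring ≤ T → (subringCentre T O hT).IsMaximal) →
    ∀ g₀ : K, (∀ c : K, c ^ p ≠ g₀) →
    (∀ f₀ : K, ∃ f₁ : K, O.valuation (g₀ - f₁ ^ p) < O.valuation (g₀ - f₀ ^ p)) →
    (∀ hk : ∀ c : k, algebraMap k K c ∈ O, transcendenceDefect k O hk ≠ 0) →
    ¬ (∃ π : K, π ≠ 0 ∧ (∀ x : K, O.valuation x < 1 → O.valuation x ≤ O.valuation π) ∧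
      (∀ x : K, x ≠ 0 → ∃ n : ℕ, O.valuation π ^ n ≤ O.valuation x)) →
    ¬ (∃ (O₁ : ValuationSubring K), O ≤ O₁ ∧ O₁ ≠ ⊤ ∧ ∃ y : Fin 2 → K, (∀ i, y i ∈ O) ∧
      ∀ P : MvPolynomial (Fin 2) k, P ≠ 0 → O₁.valuation (MvPolynomial.aeval y P) = 1) →
    ¬ (PerfectField k ∧ ∃ x y : K, x ≠ 0 ∧ y ≠ 0 ∧ ∀ a b : ℕ, a < p → b < p → (a ≠ 0 ∨ b ≠ 0) →
      ∀ z : K, z ≠ 0 → O.valuation (x ^ a * y ^ b) ≠ O.valuation (z ^ p)) →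
    ∃ (A' : Subalgebra k K), A'.toSubring ≤ O.toSubring ∧ A ≤ A' ∧ A'.FG ∧
    ∃ (_ : IsRegularLocalRing (locAtCentre A'.toSubring O)) (c : Fin p → K), (∃ j : Fin p, (j : ℕ) ≠ 0 ∧ c j ≠ 0) ∧
    ((∃ (d m : ℕ) (hmd : m ≤ d) (t : Fin d → ↥(locAtCentre A'.toSubring O)) (a : Fin m → ℕ) (u : ↥(locAtCentre A'.toSubring O)), IsUnit u ∧
    Ideal.span (Set.range t) = IsLocalRing.maximalIdeal ↥(locAtCentre A'.toSubring O) ∧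
    ringKrullDim ↥(locAtCentre A'.toSubring O) = (d : WithBot ℕ∞) ∧ 0 < m ∧ (∀ i, ¬ p ∣ a i) ∧
    (∑ j : Fin p, c j ^ p * g₀ ^ (j : ℕ)) = (u : K) * ∏ i : Fin m, ((t (Fin.castLE hmd i) : ↥(locAtCentre A'.toSubring O)) : K) ^ (a i)) ∨
    (∃ u : ↥(locAtCentre A'.toSubring O), IsUnit u ∧ (∑ j : Fin p, c j ^ p * g₀ ^ (j : ℕ)) = (u : K) ∧
    ∀ c' : ↥(locAtCentre A'.toSubring O), u - c' ^ p ∉ IsLocalRing.maximalIdeal ↥(locAtCentre A'.toSubring O)) ∨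
    (∃ s c' : ↥(locAtCentre A'.toSubring O), (∑ j : Fin p, c j ^ p * g₀ ^ (j : ℕ)) = (s : K) ∧
    s - c' ^ p ∈ IsLocalRing.maximalIdeal ↥(locAtCentre A'.toSubring O) ∧
    s - c' ^ p ∉ IsLocalRing.maximalIdeal ↥(locAtCentre A'.toSubring O) ^ 2)) := by
  intro hp k _ _ _ K _ _ O A hAO hAfg hfrac hdimA hreg hdim3 hzd g₀ hg₀ _ _ _ _ _
  exact cleanLU3_algClosed_of_cossart1987Thm p h hp k K O A hAO hAfg hfrac hdimA hreg hdim3 hzd g₀ hg₀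

end Summit.ResolutionOfSingularities.ResolutionOfSingularities.Theorems.RadicialJung.CleanModels.Lens5.KbarCossart

end
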